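import Mathlib.CategoryTheory.Groupoid.Discrete
import Literature.IUT.HodgeTheaters.PMBaseProcessionsProofs
import Literature.IUT.HodgeTheaters.PMBaseKitModel
import HarnessLib

/-!
# [IUTchI] Cor 6.10 (iv): the named statement `DThetaPMEllHT.CoreCompat` (F-2033) is a SCHEMA in its functor
# parameter `core4` — closed universal-closure certificate (proof-only)

S. Mochizuki, *Inter-universal Teichmüller theory I*, kurims manuscript, §6, Corollary 6.10 (iv) p. 172: "The
constructions of (i), (ii), (iii) are compatible, respectively, with the constructions of Corollary 4.12, (i), (ii), (iii),
relative to the functor [i.e., determined by the functorial algorithm] of Proposition 6.7, in the evident sense"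
[claim: Mochizuki2012, status: disputed] (IUTchI §6 Cor 6.10 (iv), kurims p.172).  abc-iut cell, block F (FACT-proving
wave, D-0078 rung A2.C), seat abc-iut-f-130 (gen 8); FACT-LIST row **F-2033** `DThetaPMEllHT.CoreCompat` of abc-iut-F-lit's
`LF-REFUTED-WITHOUT-REFUTER.tsv` (2026-08-27T06:44Z: label «universal-closure REFUTED; instance form PROVED», but NO
kernel refuter of record; abc-iut-L5-t13: «parametrised-by-design»).  PROOF-ONLY companion (0 `def`, 0 `instance`) of
abc-iut-L5-t4's `PMBaseProcessions.lean` (the named statement, with abc-iut-L5-t3's Cor 4.12 (i) functor as the PARAMETER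
`core4`) and `PMBaseProcessionsProofs.lean` (`DThetaPMEllHT.coreCompat_monoCodomain`: the instance form at the genuine
parameter `core4 := (𝒟-Θ-bridge ↦ †𝔇_> ↦ †𝔇^⊢_>)`, PROVED); over abc-iut-L5-t4/t7's model kit `PMBaseKit.toyKit` and the
model Hodge theater `Ex62.ht` ([IUTchI] Ex 6.2 (i)).  Nothing of record is edited or re-typed.

* `PMBaseKit.not_forall_coreCompat` — at `l := 3`, the toy kit, the §4-input kit `M` whose category of `𝒟^⊢`-prime-strips
  is the two-object discrete groupoid `{true, false}` with mono-analyticization `:= true`, and the parameter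
  `core4 := false` (a "Cor 4.12 (i) functor" that is NOT the mono-analyticization of the codomain), the statement
  fails at the model Hodge theater `Ex62.ht`: the universal closure of F-2033 (over kits, §4-kits, `core4`) is FALSE.
  Instance form of record: `DThetaPMEllHT.coreCompat_monoCodomain` (BY NAME; holds for every kit).

FACT-LIST currency: «universal-closure REFUTED / schema in the parameter `core4`; instance form PROVED
(`coreCompat_monoCodomain`)» WITH a kernel refuter of record.  HONEST FRAMING: a refuted universal closure is a
statement about OUR typing (a free functor parameter at a two-object toy), not about print's Cor 6.10 (iv), whose functor IS
the one of Cor 4.12 (i); the [IUTchI] claim key `Mochizuki2012` is DISPUTED (D-0012) and nothing of it is asserted; no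
side is taken on [IUTchIII] Cor. 3.12; typed ≠ proved; nothing here asserts abc proved or refuted.
-/

noncomputable section

namespace Literature.IUT.HodgeTheaters

open CategoryTheory

namespace PMBaseKit

/-- **F-2033 is a schema in `core4`** ([IUTchI] Cor 6.10 (iv) p.172, named statement `DThetaPMEllHT.CoreCompat`): over
the toy kit at `l = 3`, with `𝒟^⊢`-prime-strips valued in the two-object discrete groupoid on `Bool`
(mono-analyticization `:= true`) and the parameter `core4 := false`, the model `𝒟-Θ^{±ell}`-Hodge theater `Ex62.ht`
violates the statement — the universal closure is FALSE. [claim: Mochizuki2012, status: disputed] (IUTchI §6 Cor 6.10 (iv), kurims p.172) -/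
theorem not_forall_coreCompat :
    ¬ ∀ (l : ℕ) [Fact l.Prime] (K : PMBaseKit.{0} l) (M : K.MultKit) (core4 : K.DThetaBridgeData → M.DMono)
        (hl : Odd l), DThetaPMEllHT.CoreCompat K M core4 hl := by
  intro h
  haveI : Fact (Nat.Prime 3) := ⟨Nat.prime_three⟩
  haveI : NeZero (3 : ℕ) := ⟨by decide⟩
  let K : PMBaseKit.{0} 3 := toyKit 3 (by decide)
  let M : K.MultKit :=
    { DMono := Discrete Bool
      mono := fun _ => ⟨true⟩
      monoMap := fun _ => 𝟙 _
      thetaPolyBad := fun _ _ _ => ∅ }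
  have key := h 3 K M (fun _ => ⟨false⟩) (by decide) (Ex62.ht K)
  have key' : (false : Bool) = true := congrArg Discrete.as key
  exact Bool.false_ne_true key'

end PMBaseKit

end Literature.IUT.HodgeTheaters

end
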